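import Summits.BirchSwinnertonDyer.BirchSwinnertonDyer.Theorems.AdditiveKolyvaginRoadKolyvaginPrimitiveSelfCertificate
import Summits.BirchSwinnertonDyer.BirchSwinnertonDyer.Theorems.AdditiveKolyvaginRoadLevelKolyvaginSystemsAdditiveIffKolyvaginPrimitive
import HarnessLib

/-!
# Route `AdditiveKolyvaginRoad`, cruxes KS′ `LevelKolyvaginSystemsAdditive` (item stmt-BirchSwinnertonDyer-21396) and
# KPA′ `KolyvaginPrimitiveAdditive` (item stmt-BirchSwinnertonDyer-21400):
# KOLYVAGIN'S CONJECTURE MOD `p` ABOVE THE BOTTOM — the canonical residual of both cruxes, and line `epsilon_matched_retyping` WITHOUT Kriz–Li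
# (cell `pub/bsd-wall`, width seat `bsd-wall-akr-p2x-w2` g7; `--supports stmt-BirchSwinnertonDyer-21396`, helper; part 2 of 2, part 1 =
# `…KolyvaginPrimitiveSelfCertificate`, p634919, imported here for the bottom witness)

WHY.  Part 1 shows that the on-locus mechanism of skeleton v12 (avatar + log certificate + Kriz–Li 1.16) certifies only frames whose BOTTOM class
`c(1)` is non-zero — frames the bottom class certifies by itself, with no named fact.  THIS FILE draws the consequence for the line, BY NAME against the
route's decls:

(C) THE CANONICAL RESIDUAL.  By pure logic `KolyvaginPrimitiveAdditive ↔ AboveBottomKPA′` (§4), where `AboveBottomKPA′` := «at every ♯ frame at which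
    EVERY conductor-one Kolyvagin–Heegner datum has `c(1) = 0` in `H¹(K, E[p])` (equivalently, part 1 §1: the frame's Heegner point `y_K` IS
    `p`-divisible in `E(K)`; BSD-conjecturally, as `p ∤ c·∏c_ℓ` and `E(K)[p] = 0`: the frames with `Ш(E/K)[p] ≠ 0`), some Kolyvagin–Heegner datum of
    Kolyvagin-prime support has non-zero class mod `p`» — Kolyvagin's conjecture mod `p` at an additive `p ≥ 5` ABOVE THE BOTTOM (in print only for
    `p ∤ N`: W. Zhang 2014 Thm. 1.1 ∕ 9.1 with `p`-Selmer rank `≥ 3`, through the rank-0 anchor Thm. 7.1 = Skinner–Urban; OPEN at `p² ∣ N`).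
    `KL → OffLocusKPA′ → AboveBottomKPA′` (§4: skeleton v12's residual S1″ implies it, granted the fact v12 displays anyway), and
    `PUB → DUAL → AboveBottomKPA′ → KS′`, `PUB → DUAL → KS′ → AboveBottomKPA′` (§5): the Kriz–Li fact can be DROPPED from the line with a residual that
    is no larger — skeleton v13 = {S1‴ `AboveBottomKPA′` (research), S0″ = PUB ∧ DUAL}.

WHAT:
* §4 `kolyvaginPrimitiveAdditive_iff_aboveBottom` (pure logic, the bottom witness being part 1's `kolyvaginPrimitiveAdditive_conclusion_of_bottom`);
  `aboveBottom_of_thm116_of_offGoodAvatarLocus` (`KL → OffLocusKPA′ → AboveBottomKPA′`).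
* §5 `levelKolyvaginSystemsAdditive_of_published_of_aboveBottom` (`PUB → DUAL → AboveBottomKPA′ → KS′`);
  `aboveBottom_of_published_of_levelKolyvaginSystemsAdditive` (`PUB → DUAL → KS′ → AboveBottomKPA′`);
  `levelKolyvaginSystemsAdditive_iff_aboveBottom_of_published` (`PUB → DUAL → (KS′ ↔ AboveBottomKPA′)`).
`AboveBottomKPA′` and `OffLocusKPA′` are spelled out in binders (no definition is introduced); `OffLocusKPA′` is v12's S1″ VERBATIM.

HONEST FRAMING: theorems only; 0 definitions, 0 named facts introduced, 0 `sorry`.  §4's first theorem uses NO named fact; its second is conditional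
on `KrizLi2019.thm116_padicLogHeegner_congruence` BY NAME; §5 on `PublishedInputsAdditiveKoly` ∕ `PublishedDualityInputsAdditiveKoly` BY NAME and, for the
theorem concluding the crux, on the displayed research statement `AboveBottomKPA′` — OPEN, displayed, never asserted.  A REFORMULATION of where the
open mathematics sits; closes nothing.  BSD is not proved by any of this; KS′ and KPA′ remain OPEN at `p² ∣ N`; no summit statement is proved by this
file.

References: [cite: GrossLMS1991, §3 (n square-free), §4 (4.4)] [cite: McCallumLMS1991, Cor. 3.2, Cor. 4.5, Cor. 5.6] [cite: Darmon2004, Thm. 3.6]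
[cite: KrizLi2019, Thm. 1.16, Rem. 1.17] [cite: WZhang2014, Thm. 1.1, Thm. 7.1, Thm. 9.1, §5] [cite: Howard2004HeegnerKolyvagin, Lemma 2.5.3, Lemma 2.6.4]
[cite: DarmonDiamondTaylor1995, Prop. 2.12 (c)].
-/
set_option linter.dupNamespace false -- single-conjunct summit repeats the name by design

noncomputable section

open scoped Classical

namespace Summit.BirchSwinnertonDyer.BirchSwinnertonDyer.Theorems.AdditiveKoly

open WeierstrassCurve NumberField IsDedekindDomain Field
  Literature.NumberTheory.EllipticCurves Literature.NumberTheory.EllipticCurves.ModularForms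
  Literature.NumberTheory.EllipticCurves.Rank1Residual Literature.NumberTheory.GaloisRepresentations
  Summit.BirchSwinnertonDyer.Rank1Residual.X11b.Three.Koly
  Summit.BirchSwinnertonDyer.BirchSwinnertonDyer.Theses.AdditiveKolyvaginRoad
  Summit.BirchSwinnertonDyer.Rank1Residual Summit.BirchSwinnertonDyer.Rank1Residual.Additive
  Summit.BirchSwinnertonDyer.Rank1Residual.O5

/-! ## §4 The canonical residual: Kolyvagin's conjecture mod `p` ABOVE THE BOTTOM -/


section AboveBottom

/-- **`KolyvaginPrimitiveAdditive ↔ AboveBottomKPA′` — pure logic.**  `AboveBottomKPA′` (the right-hand side, spelled out) is crux r2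
`KolyvaginPrimitiveAdditive` of route `AdditiveKolyvaginRoad` with ONE extra hypothesis at each frame: EVERY conductor-one Kolyvagin–Heegner datum
on `(Dt, β, ι)` has bottom class `c(1) = 0` in `H¹(K, E[p])` (equivalently, part 1 §1: the frame's Heegner point `y_K` IS `p`-divisible in `E(K)`;
BSD-conjecturally, with `p ∤ c·∏c_ℓ` and `E(K)[p] = 0`: `Ш(E/K)[p] ≠ 0`).  (→) restriction.  (←) at a frame where some `d₁` has `c(1) ≠ 0`, that
class is the witness with `n = 1` (`kolyvaginPrimitiveAdditive_conclusion_of_bottom`); else the hypothesis.  So the research content of crux r2 (item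
stmt-BirchSwinnertonDyer-21400) — and, modulo PUB ∕ DUAL, of crux r8 (item 21396; §5) — is Kolyvagin's conjecture mod `p` at an additive `p ≥ 5`
ABOVE THE BOTTOM, with NO named fact in the reduction.  A REFORMULATION; nothing is asserted about either side.
[cite: GrossLMS1991, §4 (4.4)] [cite: WZhang2014, Thm. 1.1, Thm. 9.1 (the induction above the bottom)] -/
theorem kolyvaginPrimitiveAdditive_iff_aboveBottom :
    KolyvaginPrimitiveAdditive ↔
    (∀ (W : WeierstrassCurve ℚ) [W.IsElliptic] [W.IsGloballyMinimal] [NeZero (W.conductorNorm ℤ)]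
      (p : ℕ) [Fact p.Prime] (K : Type) [Field K] [NumberField K]
      (Dt : ModularParametrizationData W (W.conductorNorm ℤ)) (β : ℤ) (ι : K →+* ℂ),
      5 ≤ p → Addv W p → W.HasSurjectiveModNGaloisRep p →
      (∀ (ℓ : ℕ) [Fact ℓ.Prime], W.HasMultiplicativeReductionAtPrime ℓ → ¬ p ∣ padicValInt ℓ W.minimalDiscriminantInt) →
      (∃ (ℓ₁ ℓ₂ : ℕ) (_ : Fact ℓ₁.Prime) (_ : Fact ℓ₂.Prime), ℓ₁ ≠ ℓ₂ ∧
        W.HasMultiplicativeReductionAtPrime ℓ₁ ∧ W.HasMultiplicativeReductionAtPrime ℓ₂) →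
      ¬ p ∣ W.tamagawaProduct → W.analyticRank = 1 → IsImaginaryQuadratic K → Odd (NumberField.discr K) →
      NumberField.discr K < -4 → SatisfiesHeegnerHypothesis (W.conductorNorm ℤ) K →
      (W.quadraticTwist (NumberField.discr K : ℚ)).entireLFunction 1 ≠ 0 →
      (4 * (W.conductorNorm ℤ : ℤ)) ∣ β ^ 2 - NumberField.discr K → ¬ (p : ℤ) ∣ Dt.c →
      (∀ d₁ : KolyvaginHeegnerData Dt β ι 1, d₁.kolyvaginClass (Fact.out : p.Prime) 1 = 0) →
      ∃ (n : ℕ) (d : KolyvaginHeegnerData Dt β ι n),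
        KolyvaginDescent.KolSupp (Zhang2014.IsKolyvaginPrime (W.conductorNorm ℤ) W K p) n ∧
          d.kolyvaginClass (Fact.out : p.Prime) 1 ≠ 0) := by
  constructor
  · -- restriction
    intro hKPA W _ _ _ p _ K _ _ Dt β ι hp hadd hs hsp htwo htam hr hK hodd hlt hH hL hβ hc _
    exact hKPA W p K Dt β ι hp hadd hs hsp htwo htam hr hK hodd hlt hH hL hβ hc
  · -- at the bottom: the bottom class; above it: the hypothesis
    intro hAbove W _ _ _ p _ K _ _ Dt β ι hp hadd hs hsp htwo htam hr hK hodd hlt hH hL hβ hc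
    by_cases hbot : ∃ d₁ : KolyvaginHeegnerData Dt β ι 1, d₁.kolyvaginClass (Fact.out : p.Prime) 1 ≠ 0
    · exact kolyvaginPrimitiveAdditive_conclusion_of_bottom W p K Dt β ι hbot
    · push Not at hbot
      exact hAbove W p K Dt β ι hp hadd hs hsp htwo htam hr hK hodd hlt hH hL hβ hc hbot

/-- **`KrizLi 1.16 → OffLocusKPA′ → AboveBottomKPA′`** — skeleton v12's research residual S1″ (KPA′'s conclusion at the ♯ frames OFF the slim
good-avatar locus) IMPLIES v13's (KPA′'s conclusion at the ♯ frames ABOVE THE BOTTOM), granted the named fact v12 displays anyway: a frame ON the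
locus has `c(1) ≠ 0` for every conductor-one datum (w3's transfer `kolyvaginClass_one_ne_zero_of_thm116_of_lossless`, as in part 1 §3; a datum exists by
Darmon Thm. 3.6), so a frame at which all bottom classes vanish is OFF the locus, where `hOff` applies.  (The lead's
`kolyvaginPrimitiveAdditive_iff_offGoodAvatarLocus_of_thm116`, p633401, says the same through KPA′.)  Hence re-typing the residual as `AboveBottomKPA′`
and DROPPING Kriz–Li from the line loses no frame.  CONDITIONAL on `hKL`.  [cite: KrizLi2019, Thm. 1.16] [cite: GrossLMS1991, §4 (4.4)]
[cite: Darmon2004, Thm. 3.6] -/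
theorem aboveBottom_of_thm116_of_offGoodAvatarLocus (hKL : KrizLi2019.thm116_padicLogHeegner_congruence)
    (hOff : ∀ (W : WeierstrassCurve ℚ) [W.IsElliptic] [W.IsGloballyMinimal] [NeZero (W.conductorNorm ℤ)]
      (p : ℕ) [Fact p.Prime] (K : Type) [Field K] [NumberField K]
      (Dt : ModularParametrizationData W (W.conductorNorm ℤ)) (β : ℤ) (ι : K →+* ℂ),
      5 ≤ p → Addv W p → W.HasSurjectiveModNGaloisRep p →
      (∀ (ℓ : ℕ) [Fact ℓ.Prime], W.HasMultiplicativeReductionAtPrime ℓ → ¬ p ∣ padicValInt ℓ W.minimalDiscriminantInt) →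
      (∃ (ℓ₁ ℓ₂ : ℕ) (_ : Fact ℓ₁.Prime) (_ : Fact ℓ₂.Prime), ℓ₁ ≠ ℓ₂ ∧
        W.HasMultiplicativeReductionAtPrime ℓ₁ ∧ W.HasMultiplicativeReductionAtPrime ℓ₂) →
      ¬ p ∣ W.tamagawaProduct → W.analyticRank = 1 → IsImaginaryQuadratic K → Odd (NumberField.discr K) →
      NumberField.discr K < -4 → SatisfiesHeegnerHypothesis (W.conductorNorm ℤ) K →
      (W.quadraticTwist (NumberField.discr K : ℚ)).entireLFunction 1 ≠ 0 →
      (4 * (W.conductorNorm ℤ : ℤ)) ∣ β ^ 2 - NumberField.discr K → ¬ (p : ℤ) ∣ Dt.c →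
      ¬ (∃ (W₀ : WeierstrassCurve ℚ) (_ : W₀.IsElliptic) (_ : W₀.IsGloballyMinimal) (_ : NeZero (W₀.conductorNorm ℤ))
        (Dt₀ : ModularParametrizationData W₀ (W₀.conductorNorm ℤ)) (e : geomTorsion W (p : ℤ) ≃+ geomTorsion W₀ (p : ℤ)),
        (∀ (σ : absoluteGaloisGroup ℚ) (P : geomTorsion W (p : ℤ)), e (σ • P) = σ • e P) ∧
        W₀.HasGoodReductionAtPrime p ∧ ¬ (p : ℤ) ∣ W₀.frobeniusTrace p - 1 ∧
        (∀ (ℓ : ℕ) [Fact ℓ.Prime], W₀.HasMultiplicativeReductionAtPrime ℓ →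
          ¬ p ∣ padicValInt ℓ W₀.minimalDiscriminantInt) ∧
        (∀ q : ℕ, q.Prime → (q ∣ p * W.conductorNorm ℤ ↔ q ∣ p * W₀.conductorNorm ℤ)) ∧
        (∀ (ℓ : ℕ) [Fact ℓ.Prime], W.HasMultiplicativeReductionAtPrime ℓ ↔ W₀.HasMultiplicativeReductionAtPrime ℓ) ∧
        SatisfiesHeegnerHypothesis (W₀.conductorNorm ℤ) K ∧ ¬ (p : ℤ) ∣ Dt₀.c ∧
        ∃ (ιp : K →+* ℚ_[p]) (H₀ : HeegnerDatum (W₀.conductorNorm ℤ) (NumberField.discr K))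
          (y₀ : (W₀.baseChange K).toAffine.Point),
          WeierstrassCurve.Affine.Point.map ι.toRatAlgHom y₀ = heegnerPointComplex Dt₀ H₀ ∧
            ¬ ∃ Q : (W₀.baseChange ℚ_[p]).toAffine.Point, (p : ℤ) • Q = X11b.padicPointOf W₀ p ιp y₀) →
      ∃ (n : ℕ) (d : KolyvaginHeegnerData Dt β ι n),
        KolyvaginDescent.KolSupp (Zhang2014.IsKolyvaginPrime (W.conductorNorm ℤ) W K p) n ∧
          d.kolyvaginClass (Fact.out : p.Prime) 1 ≠ 0) :
    ∀ (W : WeierstrassCurve ℚ) [W.IsElliptic] [W.IsGloballyMinimal] [NeZero (W.conductorNorm ℤ)]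
      (p : ℕ) [Fact p.Prime] (K : Type) [Field K] [NumberField K]
      (Dt : ModularParametrizationData W (W.conductorNorm ℤ)) (β : ℤ) (ι : K →+* ℂ),
      5 ≤ p → Addv W p → W.HasSurjectiveModNGaloisRep p →
      (∀ (ℓ : ℕ) [Fact ℓ.Prime], W.HasMultiplicativeReductionAtPrime ℓ → ¬ p ∣ padicValInt ℓ W.minimalDiscriminantInt) →
      (∃ (ℓ₁ ℓ₂ : ℕ) (_ : Fact ℓ₁.Prime) (_ : Fact ℓ₂.Prime), ℓ₁ ≠ ℓ₂ ∧
        W.HasMultiplicativeReductionAtPrime ℓ₁ ∧ W.HasMultiplicativeReductionAtPrime ℓ₂) →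
      ¬ p ∣ W.tamagawaProduct → W.analyticRank = 1 → IsImaginaryQuadratic K → Odd (NumberField.discr K) →
      NumberField.discr K < -4 → SatisfiesHeegnerHypothesis (W.conductorNorm ℤ) K →
      (W.quadraticTwist (NumberField.discr K : ℚ)).entireLFunction 1 ≠ 0 →
      (4 * (W.conductorNorm ℤ : ℤ)) ∣ β ^ 2 - NumberField.discr K → ¬ (p : ℤ) ∣ Dt.c →
      (∀ d₁ : KolyvaginHeegnerData Dt β ι 1, d₁.kolyvaginClass (Fact.out : p.Prime) 1 = 0) →
      ∃ (n : ℕ) (d : KolyvaginHeegnerData Dt β ι n),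
        KolyvaginDescent.KolSupp (Zhang2014.IsKolyvaginPrime (W.conductorNorm ℤ) W K p) n ∧
          d.kolyvaginClass (Fact.out : p.Prime) 1 ≠ 0 := by
  intro W _ _ _ p _ K _ _ Dt β ι hp hadd hs hsp htwo htam hr hK hodd hlt hH hL hβ hc hbot
  by_cases hav : (∃ (W₀ : WeierstrassCurve ℚ) (_ : W₀.IsElliptic) (_ : W₀.IsGloballyMinimal) (_ : NeZero (W₀.conductorNorm ℤ))
      (Dt₀ : ModularParametrizationData W₀ (W₀.conductorNorm ℤ)) (e : geomTorsion W (p : ℤ) ≃+ geomTorsion W₀ (p : ℤ)),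
      (∀ (σ : absoluteGaloisGroup ℚ) (P : geomTorsion W (p : ℤ)), e (σ • P) = σ • e P) ∧
      W₀.HasGoodReductionAtPrime p ∧ ¬ (p : ℤ) ∣ W₀.frobeniusTrace p - 1 ∧
      (∀ (ℓ : ℕ) [Fact ℓ.Prime], W₀.HasMultiplicativeReductionAtPrime ℓ →
        ¬ p ∣ padicValInt ℓ W₀.minimalDiscriminantInt) ∧
      (∀ q : ℕ, q.Prime → (q ∣ p * W.conductorNorm ℤ ↔ q ∣ p * W₀.conductorNorm ℤ)) ∧
      (∀ (ℓ : ℕ) [Fact ℓ.Prime], W.HasMultiplicativeReductionAtPrime ℓ ↔ W₀.HasMultiplicativeReductionAtPrime ℓ) ∧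
      SatisfiesHeegnerHypothesis (W₀.conductorNorm ℤ) K ∧ ¬ (p : ℤ) ∣ Dt₀.c ∧
      ∃ (ιp : K →+* ℚ_[p]) (H₀ : HeegnerDatum (W₀.conductorNorm ℤ) (NumberField.discr K))
        (y₀ : (W₀.baseChange K).toAffine.Point),
        WeierstrassCurve.Affine.Point.map ι.toRatAlgHom y₀ = heegnerPointComplex Dt₀ H₀ ∧
          ¬ ∃ Q : (W₀.baseChange ℚ_[p]).toAffine.Point, (p : ℤ) • Q = X11b.padicPointOf W₀ p ιp y₀)
  · -- on the locus every conductor-one datum has `c(1) ≠ 0` (w3's transfer), contradicting `hbot`; a datum exists (Darmon Thm. 3.6)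
    exfalso
    obtain ⟨d⟩ := nonempty_kolyvaginHeegnerData_one W K Dt β ι hK hβ
    obtain ⟨W₀, _, _, _, Dt₀, e, he, hgood₀, hna, hsp₀, hrad, htype, hH₀, hc₀, ιp, hcert⟩ := hav
    have hsplit : ((Ideal.span {(p : ℤ)}).primesOver (𝓞 K)).ncard = 2 :=
      hH p (Fact.out : p.Prime) ((W.dvd_conductorNorm_iff_not_hasGoodReductionAtPrime p).mpr hadd.1)
    have hsign : ∀ (ℓ : ℕ) [Fact ℓ.Prime], W₀.HasMultiplicativeReductionAtPrime ℓ → W.LFunction ℓ = W₀.LFunction ℓ :=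
      sign_agreement_of_torsionCongr W W₀ p hp hadd hsp₀ htype e he
    exact kolyvaginClass_one_ne_zero_of_thm116_of_lossless W p K Dt β ι hKL hp hadd hs hK hlt hH hc W₀ e he hgood₀ hna
      (hdep_of_sign W W₀ p hrad htype hsign) Dt₀ hc₀ hH₀ hsplit ιp hcert d (hbot d)
  · exact hOff W p K Dt β ι hp hadd hs hsp htwo htam hr hK hodd hlt hH hL hβ hc hav

end AboveBottom

/-! ## §5 Crux r8 KS′ from ∕ to the residual above the bottom (PUB, DUAL) -/

section LevelSystems

/-- **`PUB → DUAL → AboveBottomKPA′ → LevelKolyvaginSystemsAdditive`** — the composition of skeleton v13 of line `epsilon_matched_retyping` with its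
one research stub DISPLAYED as the hypothesis `hAbove`: `AboveBottomKPA′` is KPA′ by pure logic (§4), and KPA′ gives KS′ through the lead's by-name door
`levelKolyvaginSystemsAdditive_of_kolyvaginPrimitiveAdditive_of_published` (p629856: frame-wise socket — mixed Selmer spaces, twin dichotomy from
Poitou–Tate, odd bottom rank from PUB + Cassels–Tate).  NO Kriz–Li.  CONDITIONAL on PUB ∕ DUAL by name and on the displayed research statement
`hAbove` (Kolyvagin's conjecture mod `p` above the bottom at additive `p ≥ 5` — OPEN).
[cite: WZhang2014, Thm. 1.1, Thm. 9.1, §5] [cite: Howard2004HeegnerKolyvagin, Lemma 2.5.3, Lemma 2.6.4] [cite: McCallumLMS1991, Cor. 3.2] -/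
theorem levelKolyvaginSystemsAdditive_of_published_of_aboveBottom (hPUB : PublishedInputsAdditiveKoly)
    (hDual : PublishedDualityInputsAdditiveKoly)
    (hAbove : ∀ (W : WeierstrassCurve ℚ) [W.IsElliptic] [W.IsGloballyMinimal] [NeZero (W.conductorNorm ℤ)]
      (p : ℕ) [Fact p.Prime] (K : Type) [Field K] [NumberField K]
      (Dt : ModularParametrizationData W (W.conductorNorm ℤ)) (β : ℤ) (ι : K →+* ℂ),
      5 ≤ p → Addv W p → W.HasSurjectiveModNGaloisRep p →
      (∀ (ℓ : ℕ) [Fact ℓ.Prime], W.HasMultiplicativeReductionAtPrime ℓ → ¬ p ∣ padicValInt ℓ W.minimalDiscriminantInt) →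
      (∃ (ℓ₁ ℓ₂ : ℕ) (_ : Fact ℓ₁.Prime) (_ : Fact ℓ₂.Prime), ℓ₁ ≠ ℓ₂ ∧
        W.HasMultiplicativeReductionAtPrime ℓ₁ ∧ W.HasMultiplicativeReductionAtPrime ℓ₂) →
      ¬ p ∣ W.tamagawaProduct → W.analyticRank = 1 → IsImaginaryQuadratic K → Odd (NumberField.discr K) →
      NumberField.discr K < -4 → SatisfiesHeegnerHypothesis (W.conductorNorm ℤ) K →
      (W.quadraticTwist (NumberField.discr K : ℚ)).entireLFunction 1 ≠ 0 →
      (4 * (W.conductorNorm ℤ : ℤ)) ∣ β ^ 2 - NumberField.discr K → ¬ (p : ℤ) ∣ Dt.c →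
      (∀ d₁ : KolyvaginHeegnerData Dt β ι 1, d₁.kolyvaginClass (Fact.out : p.Prime) 1 = 0) →
      ∃ (n : ℕ) (d : KolyvaginHeegnerData Dt β ι n),
        KolyvaginDescent.KolSupp (Zhang2014.IsKolyvaginPrime (W.conductorNorm ℤ) W K p) n ∧
          d.kolyvaginClass (Fact.out : p.Prime) 1 ≠ 0) :
    LevelKolyvaginSystemsAdditive :=
  levelKolyvaginSystemsAdditive_of_kolyvaginPrimitiveAdditive_of_published hPUB hDual
    (kolyvaginPrimitiveAdditive_iff_aboveBottom.mpr hAbove)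

/-- **`PUB → DUAL → LevelKolyvaginSystemsAdditive → AboveBottomKPA′`** — EXACTNESS of v13's residual: it is implied by the crux KS′ itself together
with the published inputs (the tree's BOT′-free converse `kolyvaginPrimitiveAdditive_of_published_of_levelSystems : PUB → DUAL → KS′ → KPA′`, then
restriction §4).  So no weaker residual exists on the line modulo PUB ∕ DUAL.  CONDITIONAL on PUB ∕ DUAL by name.
[cite: WZhang2014, Thm. 9.1, §5] [cite: McCallumLMS1991, Cor. 5.6] -/
theorem aboveBottom_of_published_of_levelKolyvaginSystemsAdditive (hPUB : PublishedInputsAdditiveKoly)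
    (hDual : PublishedDualityInputsAdditiveKoly) (hKS : LevelKolyvaginSystemsAdditive) :
    ∀ (W : WeierstrassCurve ℚ) [W.IsElliptic] [W.IsGloballyMinimal] [NeZero (W.conductorNorm ℤ)]
      (p : ℕ) [Fact p.Prime] (K : Type) [Field K] [NumberField K]
      (Dt : ModularParametrizationData W (W.conductorNorm ℤ)) (β : ℤ) (ι : K →+* ℂ),
      5 ≤ p → Addv W p → W.HasSurjectiveModNGaloisRep p →
      (∀ (ℓ : ℕ) [Fact ℓ.Prime], W.HasMultiplicativeReductionAtPrime ℓ → ¬ p ∣ padicValInt ℓ W.minimalDiscriminantInt) →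
      (∃ (ℓ₁ ℓ₂ : ℕ) (_ : Fact ℓ₁.Prime) (_ : Fact ℓ₂.Prime), ℓ₁ ≠ ℓ₂ ∧
        W.HasMultiplicativeReductionAtPrime ℓ₁ ∧ W.HasMultiplicativeReductionAtPrime ℓ₂) →
      ¬ p ∣ W.tamagawaProduct → W.analyticRank = 1 → IsImaginaryQuadratic K → Odd (NumberField.discr K) →
      NumberField.discr K < -4 → SatisfiesHeegnerHypothesis (W.conductorNorm ℤ) K →
      (W.quadraticTwist (NumberField.discr K : ℚ)).entireLFunction 1 ≠ 0 →
      (4 * (W.conductorNorm ℤ : ℤ)) ∣ β ^ 2 - NumberField.discr K → ¬ (p : ℤ) ∣ Dt.c →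
      (∀ d₁ : KolyvaginHeegnerData Dt β ι 1, d₁.kolyvaginClass (Fact.out : p.Prime) 1 = 0) →
      ∃ (n : ℕ) (d : KolyvaginHeegnerData Dt β ι n),
        KolyvaginDescent.KolSupp (Zhang2014.IsKolyvaginPrime (W.conductorNorm ℤ) W K p) n ∧
          d.kolyvaginClass (Fact.out : p.Prime) 1 ≠ 0 :=
  kolyvaginPrimitiveAdditive_iff_aboveBottom.mp (kolyvaginPrimitiveAdditive_of_published_of_levelSystems hPUB hDual hKS)

/-- **`PUB → DUAL → (LevelKolyvaginSystemsAdditive ↔ AboveBottomKPA′)`** — crux r8 KS′ (item stmt-BirchSwinnertonDyer-21396) IS Kolyvagin's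
conjecture mod `p` above the bottom at the ♯ additive frames, modulo the two PUBLISHED bundles and NOTHING ELSE (no Kriz–Li, no avatar, no
certificate): the two previous theorems.  CONDITIONAL on PUB ∕ DUAL by name.  BSD is not proved by any of this.
[cite: WZhang2014, Thm. 1.1, Thm. 9.1] [cite: McCallumLMS1991, Cor. 3.2, Cor. 5.6] -/
theorem levelKolyvaginSystemsAdditive_iff_aboveBottom_of_published (hPUB : PublishedInputsAdditiveKoly)
    (hDual : PublishedDualityInputsAdditiveKoly) :
    LevelKolyvaginSystemsAdditive ↔
    (∀ (W : WeierstrassCurve ℚ) [W.IsElliptic] [W.IsGloballyMinimal] [NeZero (W.conductorNorm ℤ)]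
      (p : ℕ) [Fact p.Prime] (K : Type) [Field K] [NumberField K]
      (Dt : ModularParametrizationData W (W.conductorNorm ℤ)) (β : ℤ) (ι : K →+* ℂ),
      5 ≤ p → Addv W p → W.HasSurjectiveModNGaloisRep p →
      (∀ (ℓ : ℕ) [Fact ℓ.Prime], W.HasMultiplicativeReductionAtPrime ℓ → ¬ p ∣ padicValInt ℓ W.minimalDiscriminantInt) →
      (∃ (ℓ₁ ℓ₂ : ℕ) (_ : Fact ℓ₁.Prime) (_ : Fact ℓ₂.Prime), ℓ₁ ≠ ℓ₂ ∧
        W.HasMultiplicativeReductionAtPrime ℓ₁ ∧ W.HasMultiplicativeReductionAtPrime ℓ₂) →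
      ¬ p ∣ W.tamagawaProduct → W.analyticRank = 1 → IsImaginaryQuadratic K → Odd (NumberField.discr K) →
      NumberField.discr K < -4 → SatisfiesHeegnerHypothesis (W.conductorNorm ℤ) K →
      (W.quadraticTwist (NumberField.discr K : ℚ)).entireLFunction 1 ≠ 0 →
      (4 * (W.conductorNorm ℤ : ℤ)) ∣ β ^ 2 - NumberField.discr K → ¬ (p : ℤ) ∣ Dt.c →
      (∀ d₁ : KolyvaginHeegnerData Dt β ι 1, d₁.kolyvaginClass (Fact.out : p.Prime) 1 = 0) →
      ∃ (n : ℕ) (d : KolyvaginHeegnerData Dt β ι n),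
        KolyvaginDescent.KolSupp (Zhang2014.IsKolyvaginPrime (W.conductorNorm ℤ) W K p) n ∧
          d.kolyvaginClass (Fact.out : p.Prime) 1 ≠ 0) :=
  ⟨aboveBottom_of_published_of_levelKolyvaginSystemsAdditive hPUB hDual,
    levelKolyvaginSystemsAdditive_of_published_of_aboveBottom hPUB hDual⟩

end LevelSystems

end Summit.BirchSwinnertonDyer.BirchSwinnertonDyer.Theorems.AdditiveKoly

end
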